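import Literature.NumberTheory.LFunctions.Zhang2022.RepairDetShiftPSD
import Literature.NumberTheory.LFunctions.Zhang2022.RepairDetShiftPSDCertHalfThreeHalvesTwo

/-!
# Zhang (2022) §18-margin repair rung, barrier extension (cell landau-siegel §E, row S-E-p5-6 = companion triples of
# S-E-p6-2), part 2/2: the E-010 slot DISCHARGED at the detector `b⋆₃ = (1/2; 3/2, 2)` —
# `Det.FormDetPSD (Det.shiftRecipe (1/2; 3/2, 2))` is a theorem

Y. Zhang, *Discrete mean estimates and the Landau–Siegel zero*, arXiv:2211.02515v1 [Zhang2022LandauSiegel] —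
an unrefereed manuscript under adjudication. **WHAT THIS IS NOT: a claim about its Theorems 1–2, about
Landau–Siegel zeros, about Parity, or about a repaired `Margin232`. The programme SEARCHES and TYPES; no claim
about Landau–Siegel zeros, Theorems 1–2 of arXiv:2211.02515 or a repaired Margin232 until a kernel theorem says so.**

`RepairDetShift` (p460173) decides the shift-detector family `Repair.familyDetShift` with the slot
`Det.FormDetPSD (Det.shiftRecipe b)` DISPLAYED; the slot is a tree theorem at the printed `b = (1,2,3)`
(`Det.formDetPSD_shiftRecipe_std`) and at `b⋆ = (1/2; 2, 5/2)` (`Det.formDetPSD_shiftRecipe_bStar`, ls-barrier-p6,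
`RepairDetShiftPSD` p473995) and at ls-barrier-p5's earlier companion triples. Here it is PROVED at the
sign-admissible triple `b⋆₃ = (1/2; 3/2, 2)` (`Det.SignAdmissible`, gap `k = 1`, first shift `1/2`):
**`Det.formDetPSD_shiftRecipe_bStar3`**, so the family's verdict is UNCONDITIONAL there as well
(`Repair.detShift_verdict_bStar3`, `detShift_unconditional_bStar3`). Method = ls-barrier-p6's, verbatim
(`Det.formDetPSD_of_certificate` p468669 + `Det.certForm_eq_hermForm3` + `Det.hermForm3_nonneg_of_schur` p468938): the
explicit Hermitian `2 × 2` matrix polynomial `K(t)`, `t = 7πy/22`, of degree `7` of the data file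
`RepairDetShiftPSDCertHalfThreeHalvesTwo` — ls-barrier-num's EXACT rational certificate CERT-shift-1_2-3_2-2.json (f0a983103fbbbbda) transported into
`certForm`'s coordinates, so that the two scalar Schur conditions are barrier-num's certified numerators
(`S11e = (2/c₀)·Wn₂₂ ≥ 41 / 256`, `DETe = (4/c₀²)·det Wn ≥ 0`) — pivot `(2/π)·c₀ > 0`, `c₀ = 8 / 3`, and the boundary
form `bdForm` is the DIAGONAL positive form `π²·2 / 5·|a|² + 2 / 5·|b|²` (the transported certificate has
`K(0) = −β + ε·I`, so the `m_n`-coupling cancels exactly: `k₁₂(0) = π·m_n`). The recipe data at `b⋆₃` are exact: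
`W(b⋆₃) = (-(1 / 3) * I, -3 * I, 8 / 3)` (`shiftW_bStar3`), moments `(m₀, m_s, m_n, m_b, m_bs, m_bn) =
(8 / 3 - (10 / 3) * I, 16 / 3 - (26 / 3) * I, 2 - 4 * I, 16 / 3 - (14 / 3) * I, 32 / 3 - (71 / 6) * I, 4 - 5 * I)`.

Currency (C3(e)): FormDet = formula I on ONE-SIDED kinked profiles (the slot's class); that the detector's
constants ARE this form is E-det-main (open off `(1,2,3)`); nothing here is a statement about zeros. Certificate
ledger (C7′): the certificate is DATA checked by `ring`/`norm_num` in the kernel; no kit number enters a statement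
(barrier-num's generator estar-S/cert_sos.py and the json are provenance only).

References: Y. Zhang, arXiv:2211.02515v1 (2022), §2 (2.13), Lemma 2.3, (2.16); §7 Prop. 7.1 [p. 44]; §8 (8.11)–(8.23).
[cite: Zhang2022LandauSiegel, §2 Lemma 2.3; §7 Prop. 7.1; §8 (8.11)–(8.23)]
-/

noncomputable section

open Complex Real ComplexConjugate Set

namespace Literature.NumberTheory.LFunctions.Zhang2022

namespace Det

open Repair BStar3Cert

/-! ### The three Schur identities at a point (complex-norm bookkeeping) -/

/-- `Re m₀ = c₀ = 8 / 3`. [folklore] -/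
private theorem re_m0' : ((8 / 3 - (10 / 3) * I : ℂ)).re = 8 / 3 := by norm_num

/-- `‖a + ib‖² = a² + b²` for real `a, b`. [folklore] -/
private theorem normSq_re_add_im' (a b : ℝ) : ‖(a : ℂ) + I * b‖ ^ 2 = a ^ 2 + b ^ 2 := by
  rw [Complex.sq_norm, Complex.normSq_apply]; simp [sq]

/-- `Re(a + ib) = a`. [folklore] -/
private theorem re_re_add_im' (a b : ℝ) : ((a : ℂ) + I * b).re = a := by simp

/-- `(A + iB) − (c + id)(e + if)/r` in components (`r` real). [folklore] -/
private theorem sub_mul_div_ofReal' (A B c d e f r : ℝ) :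
    ((A : ℂ) + I * B) - ((c : ℂ) + I * d) * ((e : ℂ) + I * f) / (r : ℂ)
      = (((A - (c * e - d * f) / r : ℝ)) : ℂ) + I * (((B - (c * f + d * e) / r : ℝ)) : ℂ) := by
  apply Complex.ext <;>
    simp only [Complex.add_re, Complex.add_im, Complex.sub_re, Complex.sub_im, Complex.mul_re, Complex.mul_im,
      Complex.div_ofReal_re, Complex.div_ofReal_im, Complex.ofReal_re, Complex.ofReal_im, Complex.I_re,
      Complex.I_im] <;>
    ring

/-- `k₁₂(y)` in components. [folklore] -/
private theorem k12c_eq (y : ℝ) :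
    k12c y = ((π * Pre (lam * y) : ℝ) : ℂ) + I * ((π * Pim (lam * y) : ℝ) : ℂ) := by
  unfold k12c; push_cast; ring

/-- `k₁₂′(y)` in components. [folklore] -/
private theorem k12d_eq (y : ℝ) :
    k12d y = ((π * (lam * Pred (lam * y)) : ℝ) : ℂ) + I * ((π * (lam * Pimd (lam * y)) : ℝ) : ℂ) := by
  unfold k12d; push_cast; ring

/-- the coupling `p₂ = k₂₂ + i(conj m_s + m_b)` in components: `(k₂₂ + ρ₁) + (32 / 3)·i`. [folklore] -/
private theorem p2_eq (y : ℝ) :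
    (k22c y : ℂ) + I * (conj (16 / 3 - (26 / 3) * I : ℂ) + (16 / 3 - (14 / 3) * I))
      = ((k22c y - 4 : ℝ) : ℂ) + I * ((32 / 3 : ℝ) : ℂ) := by
  apply Complex.ext <;>
  · simp only [Complex.add_re, Complex.add_im, Complex.mul_re, Complex.mul_im, Complex.sub_re, Complex.sub_im,
      Complex.I_re, Complex.I_im, Complex.conj_re, Complex.conj_im,
      Complex.ofReal_re, Complex.ofReal_im, Complex.div_ofNat_re, Complex.div_ofNat_im, Complex.re_ofNat,
      Complex.im_ofNat  ]
    ring

/-- the block entry `q₁₂ = iπ²m_bn + k₁₂′ − k₁₁` in components. [folklore] -/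
private theorem q12_eq (y : ℝ) :
    I * π ^ 2 * (4 - 5 * I : ℂ) + k12d y - (k11c y : ℂ)
      = ((π ^ 2 * 5 + π * (lam * Pred (lam * y)) - π ^ 2 * P11 (lam * y) : ℝ) : ℂ)
        + I * ((π ^ 2 * 4 + π * (lam * Pimd (lam * y)) : ℝ) : ℂ) := by
  rw [k12d_eq, show (π : ℂ) ^ 2 = ((π ^ 2 : ℝ) : ℂ) by push_cast; ring]
  unfold k11c
  apply Complex.ext <;>
  · simp only [Complex.add_re, Complex.add_im, Complex.sub_re, Complex.sub_im, Complex.mul_re, Complex.mul_im,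
      Complex.ofReal_re, Complex.ofReal_im, Complex.I_re, Complex.I_im,
      Complex.re_ofNat, Complex.im_ofNat
      ]
    ring

/-- `s₁₁ = π³·S11e`. [cite: Zhang2022LandauSiegel, Prop 7.1 p.44] -/
private theorem schur11 (y : ℝ) :
    k11d y - ‖conj (k12c y)‖ ^ 2 / (2 / π * ((8 / 3 - (10 / 3) * I : ℂ)).re) = π ^ 3 * S11e (lam * y) := by
  rw [re_m0', Complex.norm_conj, k12c_eq, normSq_re_add_im']
  have hπ : π ≠ 0 := Real.pi_ne_zero
  unfold k11d S11e lam
  field_simp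
  ring

/-- `s₂₂ = π·S22e`. [cite: Zhang2022LandauSiegel, Prop 7.1 p.44] -/
private theorem schur22 (y : ℝ) :
    2 * π * ((2 - 4 * I : ℂ) + (32 / 3 - (71 / 6) * I)).re + k22d y - 2 * (k12c y).re
        - ‖(k22c y : ℂ) + I * (conj (16 / 3 - (26 / 3) * I : ℂ) + (16 / 3 - (14 / 3) * I))‖ ^ 2
          / (2 / π * ((8 / 3 - (10 / 3) * I : ℂ)).re)
      = π * S22e (lam * y) := by
  have h1 : (((2 - 4 * I : ℂ) + (32 / 3 - (71 / 6) * I))).re = 38 / 3 := by norm_num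
  rw [re_m0', h1, p2_eq, normSq_re_add_im', k12c_eq, re_re_add_im']
  have hπ : π ≠ 0 := Real.pi_ne_zero
  unfold k22d k22c S22e lam
  field_simp
  ring

/-- `|s₁₂|² = π⁴·(S12re² + S12im²)`. [cite: Zhang2022LandauSiegel, Prop 7.1 p.44] -/
private theorem schur12 (y : ℝ) :
    ‖(I * π ^ 2 * (4 - 5 * I : ℂ) + k12d y - (k11c y : ℂ))
        - conj (conj (k12c y)) * ((k22c y : ℂ) + I * (conj (16 / 3 - (26 / 3) * I : ℂ) + (16 / 3 - (14 / 3) * I)))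
          / ((2 / π * ((8 / 3 - (10 / 3) * I : ℂ)).re : ℝ) : ℂ)‖ ^ 2
      = π ^ 4 * (S12re (lam * y) ^ 2 + S12im (lam * y) ^ 2) := by
  rw [re_m0', Complex.conj_conj, q12_eq, k12c_eq, p2_eq, sub_mul_div_ofReal', normSq_re_add_im']
  have hπ : π ≠ 0 := Real.pi_ne_zero
  unfold k22c S12re S12im lam
  field_simp
  ring

/-! ### The theorem -/

/-- **The E-010 slot at `b⋆₃ = (1/2; 3/2, 2)` is a theorem: `𝔅 ≥ 0` on one-sided kinked profiles for this detector.**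
Proof = `Det.formDetPSD_of_certificate` with the explicit polynomial certificate `(k₁₁, k₂₂, k₁₂)` of
`RepairDetShiftPSDCertHalfThreeHalvesTwo`: the pointwise form is the `3 × 3` Hermitian form of `certForm_eq_hermForm3`
with pivot `(2/π)c₀ > 0` and Schur data `s₁₁ = π³·S11e > 0`, `det = π⁴·DETe ≥ 0` (`schur11/22/12`, `S11e_ge`,
`DETe_nonneg` — barrier-num's certified numerators), and the boundary form is the diagonal positive form
`π²·2 / 5·|a|² + 2 / 5·|b|²`. [cite: Zhang2022LandauSiegel, §7 Prop. 7.1 p.44; §2 (2.16), Lemma 2.3] -/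
theorem formDetPSD_shiftRecipe_bStar3 : FormDetPSD (shiftRecipe bStar3) := by
  obtain ⟨hm0, hms, hmn, hmb, hmbs, hmbn⟩ := moments_bStar3
  refine formDetPSD_of_certificate k11c k22c k11d k22d k12c k12d hasDerivAt_k11c hasDerivAt_k22c
    hasDerivAt_k12c continuous_k11d continuous_k22d continuous_k12d ?_ ?_
  · intro y hy w v u
    have ht0 : 0 ≤ lam * y := mul_nonneg lam_pos.le hy.1
    have ht1 : lam * y ≤ 1 :=
      (mul_le_mul_of_nonneg_left hy.2 lam_pos.le).trans (by rw [mul_one]; exact lam_le_one)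
    rw [certForm_eq_hermForm3, hm0, hms, hmn, hmb, hmbs, hmbn]
    refine hermForm3_nonneg_of_schur (r := 2 / π * ((8 / 3 - (10 / 3) * I : ℂ)).re) (q11 := k11d y)
      (q22 := 2 * π * ((2 - 4 * I : ℂ) + (32 / 3 - (71 / 6) * I)).re + k22d y - 2 * (k12c y).re)
      (p1 := conj (k12c y)) (p2 := (k22c y : ℂ) + I * (conj (16 / 3 - (26 / 3) * I : ℂ) + (16 / 3 - (14 / 3) * I)))
      (q12 := I * π ^ 2 * (4 - 5 * I : ℂ) + k12d y - (k11c y : ℂ)) ?_ ?_ ?_ w v u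
    · rw [re_m0']; positivity
    · rw [schur11]; exact mul_pos (by positivity) (by linarith [S11e_ge ht0 ht1])
    · rw [schur11, schur22, schur12]
      have hD := DETe_nonneg ht0 ht1
      have e : π ^ 3 * S11e (lam * y) * (π * S22e (lam * y))
            - π ^ 4 * (S12re (lam * y) ^ 2 + S12im (lam * y) ^ 2)
          = π ^ 4 * DETe (lam * y) := by unfold DETe; ring
      rw [e]; exact mul_nonneg (by positivity) hD
  · intro a b
    simp only [bdForm]
    rw [hmn, k11c_zero, k22c_zero, k12c_zero]
    have e : π ^ 2 * (2 / 5) * ‖a‖ ^ 2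
          + 2 * ((π : ℂ) * ((2 : ℂ) + I * (-4 : ℂ)) * (conj a * b)).re
          + 2 / 5 * ‖b‖ ^ 2 - 2 * π * ((2 - 4 * I : ℂ) * (b * conj a)).re
        = π ^ 2 * (2 / 5) * ‖a‖ ^ 2 + 2 / 5 * ‖b‖ ^ 2 := by
      simp only [Complex.mul_re, Complex.mul_im, Complex.add_re, Complex.add_im, Complex.sub_re,
        Complex.sub_im, Complex.neg_re, Complex.neg_im, Complex.ofReal_re, Complex.ofReal_im, Complex.I_re,
        Complex.I_im, Complex.conj_re, Complex.conj_im, Complex.re_ofNat, Complex.im_ofNat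
            ]
      ring
    rw [e]; positivity

/-- The same statement with the triple displayed. [cite: Zhang2022LandauSiegel, §7 Prop. 7.1 p.44; §2 Lemma 2.3] -/
theorem formDetPSD_shiftRecipe_half_threeHalves_two : FormDetPSD (shiftRecipe ![1 / 2, 3 / 2, 2]) :=
  formDetPSD_shiftRecipe_bStar3

end Det

/-! ### Consequence for the §E family `familyDetShift`: the verdict is UNCONDITIONAL at `b⋆₃` -/

namespace Repair

open Det Det.BStar3Cert

/-- **At the detector `b⋆₃ = (1/2; 3/2, 2)` no pair of one-sided kinked legs closes the joint main-order criterion** —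
the displayed slot of `RepairDetShift` discharged: `¬ (𝔅(u)·𝔅(f) < ‖P(u,f)‖²)` for this recipe.
[cite: Zhang2022LandauSiegel, §2 (2.18), Props. 2.4–2.6, (2.32)–(2.33)] -/
theorem detShift_verdict_bStar3 {u u' f f' : ℝ → ℂ} (hu : KinkedProfile u u') (hf : KinkedProfile f f')
    (hu1 : u 1 = 0) (hf1 : f 1 = 0) :
    ¬ (FormDet (shiftRecipe bStar3) u u' * FormDet (shiftRecipe bStar3) f f'
        < ‖FormDetPolar (shiftRecipe bStar3) u u' f f'‖ ^ 2) :=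
  not_trueNeed_of_psd formDetPSD_shiftRecipe_bStar3 hu hf hu1 hf1

/-- Every member of `familyDetShift` with `b = b⋆₃` satisfies the verdict's conclusion outright.
[cite: Zhang2022LandauSiegel, §2 (2.18), (2.32)–(2.33)] -/
theorem detShift_unconditional_bStar3 (d : DetShiftDesign) (h : d.InClass) (hb : d.b = bStar3) :
    ¬ (FormDet (shiftRecipe d.b) d.u d.u' * FormDet (shiftRecipe d.b) d.f d.f'
        < ‖FormDetPolar (shiftRecipe d.b) d.u d.u' d.f d.f'‖ ^ 2) :=
  not_repairable_detShift d h (hb ▸ formDetPSD_shiftRecipe_bStar3)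

/-- Non-vacuity: the `𝔡`- and `𝔡′`-block legs of the printed design `θ₀` under this detector are members.
[cite: Zhang2022LandauSiegel, §2 (2.13), (2.21)–(2.28)] -/
theorem inClass_legs_theta0_bStar3 : (dLeg bStar3 theta0).InClass ∧ (dPrimeLeg bStar3 theta0).InClass :=
  ⟨inClass_dLeg signAdmissible_bStar3 admissible_theta0.toCalc,
    inClass_dPrimeLeg signAdmissible_bStar3 admissible_theta0.toCalc⟩

end Repair

end Literature.NumberTheory.LFunctions.Zhang2022
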